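import Summits.PneNP.PneNP.Theorems.SymmetryBudgetNoHiddenOrderValueAndPaste
import Summits.PneNP.PneNP.Theorems.SymmetryBudgetNoHiddenOrderValueOr
import Summits.PneNP.PneNP.Theorems.SymmetryBudgetNoHiddenOrderDecode
import Summits.PneNP.PneNP.Theorems.SymmetryBudgetNoHiddenOrderBitValuationRoot

/-!
# `NoHiddenOrder` (stmt-PneNP-14781), (R2c) value layer V: the value module of a label computes `CertifiedLabels.val`

Route `PneNP/SymmetryBudget`; definitions in `SymmetryBudgetNoHiddenOrderValueAndDefs.lean`.  **`Value.sem_ok_bit`**: for the value module of a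
label `L = (U, X, λ)` whose decode module starts (stage `0`) at the root `(I₀, ∅)` with `I₀ = (univ, refineIn G univ λ₀)`-type data satisfying the
walk invariant, with `F ≥ 2|V|` stages, `|V| = n`, adjacency reading `G`, and whose EXTERNAL wires read the decoding and the values
(`CertifiedLabels.val` with the bit valuation, the replay decoding, admissibility `adm`, value range `|V|`) of the candidate labels (`VOr.Ext`) and
of the part labels (`VAnd.Ext`): the output `ok` reads `val L ≠ none` and `bit b` reads "bit `b` of the value of `L`".  Proof: the last decode
stage reads `CertifiedLabels.replay (cgProcess G) L I₀ ∅` (`Decode.stateReads_walk` + `CGBits.replay_eq_result_root`); a decoded label is a leaf iff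
`|U| = 1` (walk invariant), else a section or an individualisation node according to `isAND`, and the three cases are `val_leaf`, `val_andNode_cg`
(+ `VAnd.aw_iff`, `paste_congr`) and `val_orNode` (+ `VOr.sem_orBit_iff`).  Sorry-free; supports stmt-PneNP-14781.
-/

set_option linter.dupNamespace false -- `Summit.PneNP.PneNP.…` (D-0017 single-conjunct layout)

namespace Summit.PneNP.PneNP.Theorems

open Finset Literature.Computability.Complexity Literature.Computability.Complexity.SymProg CGBits CGBits.WState BranchSum

namespace Value

variable {ι Λ : Type*} [DecidableEq ι] [DecidableEq Λ] {P : SymProg ι Λ}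
variable {V : Type*} [Fintype V] [DecidableEq V] {N n T F : ℕ} {U X : Finset V} {lam : V → ℕ}
variable {adm : CertifiedLabels.Label V → Prop} [DecidablePred adm]
variable {Vm : Value P V N n U T F X lam adm} {x : ι → Bool}
variable {G : SimpleGraph V} [DecidableRel G.Adj] {I₀ : CGInst V}

/-- The label valued. [folklore] -/
abbrev lab (_Vm : Value P V N n U T F X lam adm) : CertifiedLabels.Label V := ⟨U, X, lam⟩

/-- The valuation used: the bit valuation, replay decoding from `I₀`, admissibility `adm`, value range `|V|`. [folklore] -/
noncomputable abbrev VAL (G : SimpleGraph V) [DecidableRel G.Adj] (I₀ : CGInst V) (adm : CertifiedLabels.Label V → Prop)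
    (hn : Fintype.card V ≤ n) (L : CertifiedLabels.Label V) : Option (BVal n) :=
  CertifiedLabels.val (cgProcess G) (bitValuation G n hn) (fun L => CertifiedLabels.replay (cgProcess G) L I₀ ∅) adm (Fintype.card V) L

/-- **The hypotheses of the value module**: the decode module's global hypotheses (with `D = n`), its stage `0` at the root `(I₀, ∅)` with the
walk invariant and colours `< n`, enough stages, `|V| = n`, and the external wires of both branches. -/
structure Hyp (Vm : Value P V N n U T F X lam adm) (x : ι → Bool) (G : SimpleGraph V) [DecidableRel G.Adj] (I₀ : CGInst V)
    (hn : Fintype.card V ≤ n) : Prop where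
  /-- the decode module's hypotheses -/
  dc : Vm.Dc.Hyp x G
  /-- stage `0` reads the root start -/
  start : Vm.Dc.StateReads x 0 (start I₀ ∅)
  /-- the root satisfies the walk invariant -/
  winv : WInv G n (CGBits.start I₀ ∅)
  /-- root colours are `< n` everywhere -/
  col_lt : ∀ v, I₀.1.2 v < n
  /-- enough stages -/
  hF : Fintype.card V + Fintype.card V ≤ F
  /-- the width is the number of vertices -/
  hn' : Fintype.card V = n
  /-- the candidate wires read the candidates' decoding and values -/
  extOr : Vm.VO.Ext x (fun L => CertifiedLabels.replay (cgProcess G) L I₀ ∅) (VAL G I₀ adm hn)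
  /-- the part wires read the parts' values -/
  extAnd : Vm.VA.Ext x fun U' => VAL G I₀ adm hn ((lab Vm).part U')

variable {hn : Fintype.card V ≤ n} (h : Vm.Hyp x G I₀ hn)
include h

/-! ### The last decode stage reads the decoding of the label -/

/-- The last walk state. [folklore] -/
noncomputable abbrev SF (Vm : Value P V N n U T F X lam adm) (G : SimpleGraph V) [DecidableRel G.Adj] (I₀ : CGInst V) : WState V :=
  walk G (lab Vm) (start I₀ ∅) F

/-- The last stage reads the last walk state. [folklore] -/
theorem reads_last : Vm.Dc.StateReads x (Fin.last F) (SF Vm G I₀) :=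
  Decode.stateReads_walk h.dc (le_of_eq h.hn') h.start h.winv (fun v => h.col_lt v) F (Nat.lt_succ_self F)

/-- The last walk state satisfies the invariant, with colours `< n`. [folklore] -/
theorem winv_last : WInv G n (SF Vm G I₀) ∧ ∀ v, (SF Vm G I₀).col v < n :=
  ⟨winv_walk (le_of_eq h.hn') h.winv F, Decode.col_lt_walk h.dc.hD _ (fun v => h.col_lt v) F⟩

/-- The analysis of the last stage satisfies its hypotheses. [folklore] -/
theorem hypLast : (Vm.Dc.An (Fin.last F)).Hyp x G (SF Vm G I₀) where
  reads :=
    { mem_iff := fun u => by rw [Vm.Dc.An_mem]; exact (reads_last h).mem_iff u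
      val_iff := fun u c => by rw [Vm.Dc.An_val]; exact (reads_last h).val_iff u c
      cons_iff := fun u => by rw [Vm.Dc.An_cons]; exact (reads_last h).cons_iff u
      dead_iff := by rw [Vm.Dc.An_dead]; exact (reads_last h).dead_iff }
  adj_iff a b := by rw [Vm.Dc.An_adj]; exact h.dc.adj_iff a b
  col_lt := (winv_last h).2
  hN := h.dc.hN
  hT := h.dc.hT

/-- **The decoding of the label is the result of the last walk state.** [folklore] -/
theorem replay_eq : (CertifiedLabels.replay (cgProcess G) (lab Vm) I₀ ∅).map (fun I => I.1) = result (lab Vm) (SF Vm G I₀) :=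
  replay_eq_result_root (lab Vm) I₀ h.hF

/-- **`decOK`** reads "the label decodes". [folklore] -/
theorem sem_decOK_iff : P.sem x Vm.decOK = true ↔ CertifiedLabels.replay (cgProcess G) (lab Vm) I₀ ∅ ≠ none := by
  have hH := hypLast h
  rw [P.sem_and Vm.kind_decOK, Vm.srcs_decOK]
  simp only [mem_insert, mem_singleton, forall_eq_or_imp, forall_eq, wval_inr, DAnalysis.sem_stop_iff hH,
    P.sem_nor_singleton Vm.kind_ndead Vm.srcs_ndead, Bool.not_eq_true', ← Bool.not_eq_true, (reads_last h).dead_iff]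
  rw [ne_eq, ← Option.map_eq_none_iff (f := fun I : (cgProcess G).Inst => I.1), replay_eq h]
  unfold result
  split_ifs with hc
  · simp only [not_false_eq_true, iff_true]
    exact ⟨hc.2, by rw [hc.1]; exact Bool.false_ne_true⟩
  · simp only [not_true_eq_false, iff_false, not_and, Bool.not_eq_true]
    intro hs hd
    exact hc ⟨hd, hs⟩

/-- When the label decodes: the decoded instance is the last walk state, its block is `U`. [folklore] -/
theorem decoded {I : CGInst V} (hI : CertifiedLabels.replay (cgProcess G) (lab Vm) I₀ ∅ = some I) :
    I.1.1 = (SF Vm G I₀).A ∧ I.1.2 = (SF Vm G I₀).col ∧ (SF Vm G I₀).A = U := by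
  have hmap := replay_eq h
  rw [hI] at hmap
  change some I.1 = result (lab Vm) (SF Vm G I₀) at hmap
  unfold result at hmap
  split_ifs at hmap with hc
  have hinj := Option.some.inj hmap
  exact ⟨(congrArg Prod.fst hinj : I.1.1 = _), (congrArg Prod.snd hinj : I.1.2 = _), hc.2.1⟩

/-! ### The kind of the decoded instance -/

omit [Fintype V] h in
/-- A singleton block is connected. [folklore] -/
theorem not_isAND_of_card_eq_one {S : WState V} (h1 : S.A.card = 1) : ¬ IsAND G S := by
  rintro ⟨u, hu, hne⟩
  obtain ⟨a, ha⟩ := card_eq_one.1 h1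
  apply hne
  apply Subset.antisymm (swReach_subset _ _ _)
  intro w hw
  rw [ha, mem_singleton] at hw hu
  subst hw; subst hu
  exact self_mem_swReach _ (by rw [ha]; exact mem_singleton_self _)

/-! ### The main theorem -/

/-- **The value module computes the value of its label**: `ok` reads `val L ≠ none`, `bit b` reads "`val L = some E` with `E b = true`".
[folklore] -/
theorem sem_ok_bit :
    (P.sem x Vm.ok = true ↔ VAL G I₀ adm hn (lab Vm) ≠ none) ∧
      ∀ b, P.sem x (Vm.bit b) = true ↔ ∃ E, VAL G I₀ adm hn (lab Vm) = some E ∧ E b = true := by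
  classical
  have hH := hypLast h
  have hrl := reads_last h
  obtain ⟨hW, hcol⟩ := winv_last h
  have hdec := sem_decOK_iff h
  -- gates common to both cases
  have hff : P.sem x Vm.ff = false := by rw [← Bool.not_eq_true, P.sem_or Vm.kind_ff, Vm.srcs_ff]; simp
  by_cases hD : CertifiedLabels.replay (cgProcess G) (lab Vm) I₀ ∅ = none
  · -- the label does not decode: no value, everything off
    have hval : VAL G I₀ adm hn (lab Vm) = none := val_none (cgProcess G) (bitValuation G n hn) _ adm _ hD
    have hdk : P.sem x Vm.decOK = false := by rw [← Bool.not_eq_true, hdec]; exact fun h' => h' hD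
    refine ⟨?_, fun b => ?_⟩
    · rw [hval, P.sem_and Vm.kind_ok, Vm.srcs_ok]
      split_ifs <;> simp [hdk]
    · rw [hval, P.sem_and (Vm.kind_bit b), Vm.srcs_bit]
      simp only [reduceCtorEq, false_and, exists_false, iff_false]
      split_ifs with h1
      · intro H; have := H _ (mem_insert_self _ _); rw [wval_inr, hdk] at this; exact Bool.noConfusion this
      · intro H; have := H _ (mem_insert_self _ _); rw [wval_inr, hdk] at this; exact Bool.noConfusion this
  -- the label decodes to `I = (U, col)`, the last walk state
  obtain ⟨I, hI⟩ := Option.ne_none_iff_exists'.1 hD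
  obtain ⟨hIA, hIc, hAU⟩ := decoded h hI
  have hdk : P.sem x Vm.decOK = true := hdec.2 hD
  have hWf : Wf n I := fun u hu => by rw [hIc]; exact hW.wf u (hIA ▸ hu)
  have hEq : EqIn G I.1.1 I.1.2 := by rw [hIA, hIc]; exact hW.eqIn
  by_cases h1 : U.card = 1
  · -- a leaf: the colour of the single vertex
    obtain ⟨u₀, hu₀⟩ := card_eq_one.1 h1
    have hmemU : ∀ u, u ∈ U ↔ u = u₀ := fun u => by rw [hu₀, mem_singleton]
    have hn0 : 0 < n := by rw [← h.hn']; exact Fintype.card_pos_iff.2 ⟨u₀⟩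
    have hA1 : I.1.1.card = 1 := by rw [hIA, hAU]; exact h1
    have hleaf : cgStep G I = .leaf := by
      rw [cgStep_eq_leaf_iff]
      refine ⟨fun ⟨u, hu, hne⟩ => ?_, fun h2 => by omega⟩
      exact not_isAND_of_card_eq_one (G := G) (S := ⟨I.1.1, I.1.2, ∅, false⟩) hA1 ⟨u, hu, hne⟩
    have hval : VAL G I₀ adm hn (lab Vm) = some (leafVal G n I) := val_leaf (cgProcess G) (bitValuation G n hn) _ adm _ hI hleaf
    have hIU : ∀ u, u ∈ I.1.1 ↔ u = u₀ := fun u => by rw [hIA, hAU]; exact hmemU u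
    have henum : someEnum n I ⟨0, hn0⟩ = u₀ := by
      have hlt : ((⟨0, hn0⟩ : Fin n) : ℕ) < I.1.1.card := by rw [hA1]; exact Nat.one_pos
      exact (hIU _).1 ((isEnum_someEnum hn I).mem ⟨0, hn0⟩ hlt)
    refine ⟨?_, fun b => ?_⟩
    · rw [hval, P.sem_and Vm.kind_ok, Vm.srcs_ok, if_pos h1]
      simp [hdk]
    · rw [hval, P.sem_and (Vm.kind_bit b), Vm.srcs_bit, if_pos h1, forall_mem_insert]
      simp only [Option.some.injEq, exists_eq_left', wval_inr, hdk, true_and]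
      unfold leafVal
      rcases bit_cases b with ⟨i, c, rfl⟩ | ⟨i, j, rfl⟩
      · simp only [bdec_cIdx, bitEnc_cIdx, hA1, Nat.lt_one_iff, decide_eq_true_eq]
        split_ifs with hi
        · rw [forall_mem_image]
          have hi0 : i = ⟨0, hn0⟩ := Fin.ext hi
          constructor
          · intro H
            have := H ((hmemU u₀).2 rfl)
            rw [hrl.val_iff, ← hIc] at this
            rw [hi0, henum]; exact ⟨rfl, this⟩
          · rintro ⟨-, hc⟩ u hu
            rw [(hmemU u).1 hu, hrl.val_iff, ← hIc]
            rw [hi0, henum] at hc; exact hc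
        · simp only [mem_singleton, forall_eq, wval_inr, hff, Bool.false_eq_true, false_iff, not_and]
          exact fun hi' => absurd hi' hi
      · simp only [bdec_aIdx, bitEnc_aIdx, hA1, Nat.lt_one_iff, decide_eq_true_eq, mem_singleton, forall_eq, wval_inr, hff,
          Bool.false_eq_true, false_iff, not_and]
        intro hi hj
        have hi0 : i = ⟨0, hn0⟩ := Fin.ext hi
        have hj0 : j = ⟨0, hn0⟩ := Fin.ext hj
        rw [hi0, hj0]; exact G.irrefl
  -- at least two vertices: a section node or an individualisation node according to `isAND`
  have h2 : 2 ≤ I.1.1.card := by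
    rw [hIA, hAU]
    have := card_pos.2 (hAU ▸ hW.ne : U.Nonempty); omega
  have hok : P.sem x Vm.ok = true ↔ P.sem x Vm.a1 = true ∨ P.sem x Vm.a2 = true := by
    rw [P.sem_and Vm.kind_ok, Vm.srcs_ok, if_neg h1]
    simp only [mem_insert, mem_singleton, forall_eq_or_imp, forall_eq, wval_inr, hdk, true_and]
    rw [P.sem_or Vm.kind_okk, Vm.srcs_okk]
    simp only [mem_insert, mem_singleton, exists_eq_or_imp, exists_eq_left, wval_inr]
  have hbit : ∀ b, P.sem x (Vm.bit b) = true ↔ P.sem x (Vm.b1 b) = true ∨ P.sem x (Vm.b2 b) = true := by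
    intro b
    rw [P.sem_and (Vm.kind_bit b), Vm.srcs_bit, if_neg h1]
    simp only [mem_insert, mem_singleton, forall_eq_or_imp, forall_eq, wval_inr, hdk, true_and]
    rw [P.sem_or (Vm.kind_bb b), Vm.srcs_bb]
    simp only [mem_insert, mem_singleton, exists_eq_or_imp, exists_eq_left, wval_inr]
  have ha1 : P.sem x Vm.a1 = true ↔ IsAND G (SF Vm G I₀) ∧ P.sem x Vm.VA.andOk = true := by
    rw [P.sem_and Vm.kind_a1, Vm.srcs_a1]
    simp only [mem_insert, mem_singleton, forall_eq_or_imp, forall_eq, wval_inr, DAnalysis.sem_isAND_iff hH]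
  have ha2 : P.sem x Vm.a2 = true ↔ ¬ IsAND G (SF Vm G I₀) ∧ P.sem x Vm.VO.orOk = true := by
    rw [P.sem_and Vm.kind_a2, Vm.srcs_a2]
    simp only [mem_insert, mem_singleton, forall_eq_or_imp, forall_eq, wval_inr, DAnalysis.sem_nisAND_iff hH]
  have hb1 : ∀ b, P.sem x (Vm.b1 b) = true ↔ IsAND G (SF Vm G I₀) ∧ P.sem x Vm.VA.andOk = true ∧ wval x (P.sem x) (Vm.VA.aw b) = true := by
    intro b
    rw [P.sem_and (Vm.kind_b1 b), Vm.srcs_b1]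
    simp only [mem_insert, mem_singleton, forall_eq_or_imp, forall_eq, wval_inr, DAnalysis.sem_isAND_iff hH]
  have hb2 : ∀ b, P.sem x (Vm.b2 b) = true ↔ ¬ IsAND G (SF Vm G I₀) ∧ P.sem x (Vm.VO.orBit b) = true := by
    intro b
    rw [P.sem_and (Vm.kind_b2 b), Vm.srcs_b2]
    simp only [mem_insert, mem_singleton, forall_eq_or_imp, forall_eq, wval_inr, DAnalysis.sem_nisAND_iff hH]
  by_cases hA : IsAND G (SF Vm G I₀)
  · -- SECTION node
    have hdisc : ∃ u ∈ I.1.1, swReach G I.1.1 I.1.2 u ≠ I.1.1 := by rw [hIA, hIc]; exact hA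
    have hstep : cgStep G I = .andNode (cgParts G I) := cgStep_eq_andNode_iff.2 ⟨hdisc, rfl⟩
    set f : CGInst V → BVal n := fun J => (VAL G I₀ adm hn ((lab Vm).part J.1.1)).getD (leafVal G n J) with hfdef
    have hval : VAL G I₀ adm hn (lab Vm) =
        if ∀ J ∈ cgParts G I, VAL G I₀ adm hn ((lab Vm).part J.1.1) ≠ none then some (paste G n I f) else none :=
      val_andNode_cg (bitValuation G n hn) adm _ I₀ hI hstep (paste_congr I)
    -- the hypotheses of the section branch
    have hHA : Vm.VA.Hyp G x I :=
      { blk := hIA.trans hAU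
        step := hstep
        mem_iff := fun u => by rw [Vm.VA_mem, hIA]; exact hrl.mem_iff u
        val_iff := fun u c => by rw [Vm.VA_val, hIc]; exact hrl.val_iff u c
        reach_iff := fun u w => by rw [Vm.VA_reach, wval_inr, hIA, hIc]; exact DAnalysis.sem_reach_iff hH u w
        tw_iff := fun u hu w hw => by
          rw [Vm.VA_tw, wval_inr]
          -- the switching gadget of the last analysis reads the block
          have hpart : (Vm.Dc.An (Fin.last F)).C.S.part x = I.1.1 := by
            ext v; rw [Switching.mem_part, hIA]; unfold Switching.Mem
            rw [(Vm.Dc.An (Fin.last F)).CS_mem]; exact hH.reads.mem_iff v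
          have hreads : (Vm.Dc.An (Fin.last F)).C.S.Reads x
              (G.induce (((Vm.Dc.An (Fin.last F)).C.S.part x : Finset V) : Set V)) (fun a => I.1.2 a) :=
            { adj_iff := fun a b => by rw [(Vm.Dc.An (Fin.last F)).CS_adj]; exact hH.adj_iff a b
              eq_iff := fun a b => by
                rw [(Vm.Dc.An (Fin.last F)).CS_eq, wval_inr, hIc]; exact DAnalysis.sem_eq_iff hH a b }
          have hNS : ((Vm.Dc.An (Fin.last F)).C.S.part x).card ^ 2 ≤ N := by rw [hpart]; exact DAnalysis.card_sq_le_N hH _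
          have hu' : u ∈ (Vm.Dc.An (Fin.last F)).C.S.part x := hpart ▸ hu
          have hw' : w ∈ (Vm.Dc.An (Fin.last F)).C.S.part x := hpart ▸ hw
          rw [Switching.sem_tw_iff hreads hNS ⟨u, hu'⟩ ⟨w, hw'⟩, swComp_iff_switch, ← hpart]
          exact Iff.rfl
        wf := hWf
        hn := hn }
    by_cases hall : ∀ J ∈ cgParts G I, VAL G I₀ adm hn ((lab Vm).part J.1.1) ≠ none
    · rw [if_pos hall] at hval
      have hf : ∀ J ∈ cgParts G I, VAL G I₀ adm hn ((lab Vm).part J.1.1) = some (f J) := fun J hJ => by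
        obtain ⟨E, hE⟩ := Option.ne_none_iff_exists'.1 (hall J hJ)
        rw [hfdef]; dsimp only; rw [hE]; rfl
      have handOk : P.sem x Vm.VA.andOk = true := (VAnd.sem_andOk_iff hHA h.extAnd).2 hall
      refine ⟨?_, fun b => ?_⟩
      · rw [hok, hval, ha1]; simp only [ne_eq, reduceCtorEq, not_false_eq_true, iff_true]; exact Or.inl ⟨hA, handOk⟩
      · rw [hbit, hval, hb1, hb2, VAnd.aw_iff hHA h.extAnd hf]
        simp only [Option.some.injEq, exists_eq_left']
        constructor
        · rintro (⟨-, -, hb⟩ | ⟨hA', -⟩)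
          · exact hb
          · exact absurd hA hA'
        · intro hb; exact Or.inl ⟨hA, handOk, hb⟩
    · rw [if_neg hall] at hval
      have handOk : P.sem x Vm.VA.andOk = false := by
        rw [← Bool.not_eq_true, VAnd.sem_andOk_iff hHA h.extAnd]; exact hall
      refine ⟨?_, fun b => ?_⟩
      · rw [hok, hval, ha1, ha2, handOk]; simp [hA]
      · rw [hbit, hval, hb1, hb2, handOk]; simp [hA]
  · -- INDIVIDUALISATION node
    have hconn : ¬ ∃ u ∈ I.1.1, swReach G I.1.1 I.1.2 u ≠ I.1.1 := by rw [hIA, hIc]; exact hA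
    have hOR : IsOR G (SF Vm G I₀) := (Decode.isOR_iff_of_winv hW).2 ⟨hA, by rw [← hIA]; exact h2⟩
    have hstep : cgStep G I = .orNode (smallestCell I.1.1 I.1.2) (cgChild G I) :=
      cgStep_eq_orNode_iff.2 ⟨hconn, by rw [hIA, hIc]; exact hOR.2, rfl, rfl⟩
    have hinv := DAnalysis.inv_of_winv hW hA
    -- the hypotheses of the individualisation branch
    have hHO : Vm.VO.Hyp x G I :=
      { blk := hIA.trans hAU
        mem_iff := fun u => by rw [Vm.VO_mem, hIA]; exact hrl.mem_iff u
        val_iff := fun u c => by rw [Vm.VO_val, hIc]; exact hrl.val_iff u c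
        lt_iff := fun u v => by rw [Vm.VO_lt, wval_inr, hIc]; exact DAnalysis.sem_lt_iff hH u v
        eq_iff := fun u v => by rw [Vm.VO_eq, wval_inr, hIc]; exact DAnalysis.sem_eq_iff hH u v
        sel_iff := fun a ha => by rw [Vm.VO_sel, wval_inr, hIA, hIc]; exact DAnalysis.sem_sel_iff hH hinv (hIA ▸ ha)
        adj_iff := fun a b => by rw [Vm.VO_adj]; exact h.dc.adj_iff a b
        col_lt := fun v => by rw [hIc]; exact hcol v
        hN := (Nat.le_self_pow two_ne_zero _).trans h.dc.hN
        hT := h.dc.hT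
        hn := h.hn' }
    have hval0 := val_orNode (cgProcess G) (bitValuation G n hn) (fun L => CertifiedLabels.replay (cgProcess G) L I₀ ∅) adm
      (Fintype.card V) hI hstep
    have hval : VAL G I₀ adm hn (lab Vm) = pick n (VOr.offer Vm.VO G I (fun L => CertifiedLabels.replay (cgProcess G) L I₀ ∅) (VAL G I₀ adm hn)) :=
      hval0
    refine ⟨?_, fun b => ?_⟩
    · rw [hok, hval, ha1, ha2, VOr.sem_orOk_iff hHO h.extOr h2]
      constructor
      · rintro (⟨hA', -⟩ | ⟨-, hne⟩)
        · exact absurd hA' hA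
        · exact pick_ne_none _ hne
      · intro hne
        refine Or.inr ⟨hA, ?_⟩
        by_contra hem
        rw [not_nonempty_iff_eq_empty] at hem
        rw [hem] at hne
        exact hne (by unfold pick; rw [dif_neg]; exact not_nonempty_empty)
    · rw [hbit, hval, hb1, hb2, VOr.sem_orBit_iff hHO h.extOr hWf h2]
      constructor
      · rintro (⟨hA', -⟩ | ⟨-, hb⟩)
        · exact absurd hA' hA
        · exact hb
      · intro hb; exact Or.inr ⟨hA, hb⟩

end Value

end Summit.PneNP.PneNP.Theorems
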